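import Mathlib
import Literature.Computability.Complexity.FPStringBricks
import Literature.Computability.Complexity.TM2PassThrough
import Literature.Computability.MetaComplexity.KtViaRuler
import Literature.Computability.MetaComplexity.LevinKt
import HarnessLib

/-!
# Levin's `Kt`: the logarithmic upper bound for `1^N` and YES-side inhabitedness of `MKtP` / `Gap-MKtP`

Topic `Literature/Computability/MetaComplexity`; companion of `LevinKt.lean` (`UniversalMachine.levinKt`,
`MKtP`, `gapMKtP`). That file proves the NO side of the promise problems `Gap-MKtP[s₁, s₂]` of
Oliveira–Santhanam (FOCS 2018, Thm 3) / Oliveira–Pich–Santhanam (ToC 17(11) 2021, Thms 1.1–1.3) /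
Chen–Jin–Williams (STOC 2020, Thm 1.4) is inhabited at every large length (`exists_mem_gapMKtP_no`,
counting) and leaves the YES side — "e.g. `0^N`, `Kt = O(log N)`, by `UniversalMachine.sim` applied to a
printing machine (not formalised)" — open (census cell `pub-magnif`, `REFEREE.md` O8). This file closes
it for EVERY admissible reference machine `U : UniversalMachine`:

* `UniversalMachine.exists_levinKt_le_of_outputsWithin` — universality for `Kt`: a TM2 machine `M`
  printing `y` on `w` within `t` steps gives `Kt(y) ≤ |w| + (2|e| + 2) + ⌈log₂ p(t)⌉` (`e`, `p` the
  code and overhead polynomial of `M` from `U.sim`);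
* `UniversalMachine.levinKt_ones_le` — **`Kt(1^N) ≤ c·⌊log₂ N⌋ + c` for a constant `c = c(U)` and all
  `N`** — the standard example of a string of logarithmic `Kt`-complexity (no sentence of OPS21 is
  quoted here; the bound is folklore from Levin's definition: `Kt(x) ≥ log |x| − O(1)` for every `x`,
  since printing `x` takes `|x|` steps, with equality up to a constant factor for `1^N`);
* hence `1^N ∈ MKtP[s]` at every large length for the census thresholds: `s(N) = ⌊N^β⌋` with `β > 0`
  (`eventually_ones_mem_MKtP_powThreshold`: OS18 Thm 3, OPS21 Thms 1.1/1.2, CJW19/20 `MKtP[n^α]`) and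
  `s(N) = ⌊C (log₂ N)^d⌋` with `C ≥ 1`, `d ≥ 2` (`eventually_ones_mem_MKtP_logb_pow`: OPS21 Thm 1.3's
  `Cn²`, CJW20's `MKtP[(log n)^d]`), and the YES sides of the corresponding `Gap-MKtP` promise
  problems are inhabited at every large length (`eventually_ones_mem_gapMKtP_yes_*`).

THE PROGRAM. `1^N` is printed by the ruler machine of `KtViaRuler.lean`
(`UniversalMachine.exists_outputsWithin_ruler`) for the polynomial-time bounded binary-to-unary
conversion `binToUnaryFn ⟨r, u⟩ = 1^{min ⟦u⟧ |r|}` (`Complexity/FPStringBricks.lean`): on the program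
`⟨u, u⟩` with `u = bin(N)` (`|u| = size N ≤ log₂ N + 1`) the machine first expands the first component
to the ruler `1^{2^{|u|}} 0 u` (length `> N`) and then outputs `1^{min (N, 2^{|u|} + |u| + 1)} = 1^N`,
within `A·(2^{|u|} + |u|)^B + A = poly(N)` steps; through `U.sim` (code `e`, overhead `p`) this is a
`U`-program of length `3|u| + 2 + 2|e| + 2 = O(log N)` running in time `p(poly(N))`, whose `⌈log₂⌉` is
again `O(log N)` (`UHSParam.exists_pow_bound`). No new machine is built here.

## References

* I. C. Oliveira, J. Pich, R. Santhanam, *Hardness magnification near state-of-the-art lower bounds*,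
  Theory of Computing 17(11) (2021), Def. 2.1–2.2.
* E. Allender, H. Buhrman, M. Koucký, D. van Melkebeek, D. Ronneburger, *Power from random strings*,
  SIAM J. Comput. 35(6) (2006) 1467–1493, §2 (Levin's `Kt`; `Kt(x) ≥ log |x| − O(1)`).
* M. Li, P. Vitányi, *An Introduction to Kolmogorov Complexity and Its Applications*, §7.1
  (upper bounds by explicit programs).
-/

namespace Literature.Computability.MetaComplexity

open _root_.Computability Complexity Polynomial Turing Filter

namespace UniversalMachine

variable (U : UniversalMachine)

/-! ### Universality for `Kt` -/

/-- **Universality for `Kt`**: if a TM2 machine `M` outputs `y` on input `w` within `t` steps then,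
with `e, p` the code and overhead polynomial of `M` from `U.sim`, the `U`-program `⟨e, w⟩` prints `y`
within `p(t)` steps, so `Kt(y) ≤ |w| + (2|e| + 2) + ⌈log₂ p(t)⌉` (uniformly in `w, y, t`).
[cite: OliveiraPichSanthanam2021, Def. 2.1] -/
theorem exists_levinKt_le_of_outputsWithin (M : TM2ComputableAux Bool Bool) :
    ∃ (e : List Bool) (p : Polynomial ℕ), ∀ (w y : List Bool) (t : ℕ), M.OutputsWithin w y t →
      U.levinKt y ≤ (w.length + (2 * e.length + 2) + Nat.clog 2 (p.eval t) : ℕ) := by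
  obtain ⟨e, p, h⟩ := U.sim M
  refine ⟨e, p, fun w y t hw => (U.levinKt_le_of_run (h w y t hw)).trans ?_⟩
  rw [length_boolPair]
  exact_mod_cast le_of_eq (by ring)

/-! ### Arithmetic of the time bound -/

/-- `⌈log₂ (x·y)⌉ ≤ ⌈log₂ x⌉ + ⌈log₂ y⌉`. [folklore] -/
theorem clog_two_mul_le (x y : ℕ) : Nat.clog 2 (x * y) ≤ Nat.clog 2 x + Nat.clog 2 y := by
  apply Nat.clog_le_of_le_pow
  rw [pow_add]
  exact Nat.mul_le_mul (Nat.le_pow_clog one_lt_two x) (Nat.le_pow_clog one_lt_two y)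

/-- `⌈log₂ (x^n)⌉ ≤ n · ⌈log₂ x⌉`. [folklore] -/
theorem clog_two_pow_le (x n : ℕ) : Nat.clog 2 (x ^ n) ≤ n * Nat.clog 2 x := by
  apply Nat.clog_le_of_le_pow
  rw [mul_comm, pow_mul]
  exact Nat.pow_le_pow_left (Nat.le_pow_clog one_lt_two x) n

/-- `⌈log₂ (N + 2)⌉ ≤ ⌊log₂ N⌋ + 2`. [folklore] -/
theorem clog_two_add_two_le (N : ℕ) : Nat.clog 2 (N + 2) ≤ Nat.log 2 N + 2 := by
  apply Nat.clog_le_of_le_pow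
  have h1 : N < 2 ^ (Nat.log 2 N + 1) := Nat.lt_pow_succ_log_self one_lt_two N
  have h2 : 2 ≤ 2 ^ (Nat.log 2 N + 1) := by
    calc (2 : ℕ) = 2 ^ 1 := by norm_num
      _ ≤ 2 ^ (Nat.log 2 N + 1) := Nat.pow_le_pow_right (by norm_num) (by omega)
  rw [pow_succ]
  omega

/-! ### `Kt(1^N) = O(log N)` -/

/-- **`Kt(1^N) ≤ c·⌊log₂ N⌋ + c`** for a constant `c` depending only on the reference machine `U`:
`1^N` is printed by the `O(log N)`-bit program `⟨e, ⟨bin N, bin N⟩⟩` of the ruler machine for the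
bounded binary-to-unary conversion, in time `poly(N)` (module docstring, THE PROGRAM).
(Folklore consequence of Levin's definition, OPS21 Def. 2.1; no sentence of OPS21 is quoted.)
[cite: OliveiraPichSanthanam2021, Def. 2.1 (Kt; the bound for 1^N is folklore)] -/
theorem levinKt_ones_le : ∃ c : ℕ, ∀ N : ℕ, U.levinKt (ones N) ≤ (c * Nat.log 2 N + c : ℕ) := by
  obtain ⟨M, A, B, hM⟩ := exists_outputsWithin_ruler binToUnaryFn_mem_FP
  obtain ⟨e, p, hsim⟩ := U.exists_levinKt_le_of_outputsWithin M
  obtain ⟨d, -, hd⟩ := UHSParam.exists_pow_bound p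
  -- constants: `K` absorbs the time polynomial's leading data, `D` the exponent, `c₁ = ⌈log₂ K^{2^d}⌉`
  set K : ℕ := A * 3 ^ B + A + 2 with hK
  set D : ℕ := B * 2 ^ d with hD
  set c₁ : ℕ := Nat.clog 2 (K ^ (2 ^ d)) with hc₁
  set R : ℕ := 2 * e.length + 7 + c₁ + 2 * D with hR
  refine ⟨3 + D + R, fun N => ?_⟩
  set k : ℕ := Nat.log 2 N with hk
  -- the run of the ruler machine on `⟨bin N, bin N⟩` prints `1^N`
  have hlenE : (expPad 1 (encodeNat N)).length = 2 ^ (encodeNat N).length + (encodeNat N).length + 1 := by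
    rw [length_expPad, pow_one]
  have hNle : N ≤ (expPad 1 (encodeNat N)).length := by
    rw [hlenE]
    have h1 : N < 2 ^ (Nat.log 2 N + 1) := Nat.lt_pow_succ_log_self one_lt_two N
    have h2 : (encodeNat N).length = N.size := TM2Pass.length_encodeNat_eq_size N
    have h3 : N < 2 ^ N.size := Nat.lt_size_self N
    rw [h2]
    omega
  have hout : binToUnaryFn (boolPair (expPad 1 (encodeNat N)) (encodeNat N)) = ones N := by
    rw [binToUnaryFn_boolPair, bitsToNat_encodeNat, Nat.min_eq_left hNle]
  have hrun := hM (encodeNat N) (encodeNat N)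
  rw [hout] at hrun
  have hKt := hsim _ _ _ hrun
  refine hKt.trans ?_
  -- it remains to bound the three terms by `(3 + D + R)·k + (3 + D + R)`
  have hul : (encodeNat N).length ≤ k + 1 := TM2Pass.length_encodeNat_le N
  have h2u : 2 ^ (encodeNat N).length ≤ 2 * N + 1 := by
    -- (`= FineGrained.NSETHBridge.two_pow_length_encodeNat_le`, not imported: that module sits on
    -- the word-RAM/fine-grained stack)
    rcases Nat.eq_zero_or_pos N with hN | hN
    · subst hN
      simp [encodeNat, encodeNum]
    · calc 2 ^ (encodeNat N).length ≤ 2 ^ (Nat.log 2 N + 1) :=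
            Nat.pow_le_pow_right (by norm_num) (TM2Pass.length_encodeNat_le N)
        _ = 2 * 2 ^ Nat.log 2 N := by rw [pow_succ, mul_comm]
        _ ≤ 2 * N := Nat.mul_le_mul_left 2 (Nat.pow_log_le_self 2 hN.ne')
        _ ≤ 2 * N + 1 := Nat.le_succ _
  have hkN : k ≤ N := Nat.log_le_self 2 N
  have hZ : 2 ^ (encodeNat N).length + (encodeNat N).length ≤ 3 * (N + 2) := by omega
  set t : ℕ := A * (2 ^ (encodeNat N).length + (encodeNat N).length) ^ B + A with ht
  have hMB : 1 ≤ (N + 2) ^ B := Nat.one_le_pow _ _ (by omega)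
  have ht2 : t + 2 ≤ K * (N + 2) ^ B := by
    have h1 : (2 ^ (encodeNat N).length + (encodeNat N).length) ^ B ≤ 3 ^ B * (N + 2) ^ B := by
      rw [← mul_pow]; exact Nat.pow_le_pow_left hZ B
    have h2 : A * (2 ^ (encodeNat N).length + (encodeNat N).length) ^ B ≤ A * (3 ^ B * (N + 2) ^ B) :=
      Nat.mul_le_mul_left A h1
    have h3 : A + 2 ≤ (A + 2) * (N + 2) ^ B := Nat.le_mul_of_pos_right _ hMB
    calc t + 2 = A * (2 ^ (encodeNat N).length + (encodeNat N).length) ^ B + (A + 2) := by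
          rw [ht]; ring
      _ ≤ A * (3 ^ B * (N + 2) ^ B) + (A + 2) * (N + 2) ^ B := add_le_add h2 h3
      _ = K * (N + 2) ^ B := by rw [hK]; ring
  have hp : p.eval t ≤ K ^ (2 ^ d) * (N + 2) ^ (B * 2 ^ d) := by
    have h1 := hd t
    calc p.eval t ≤ (t + 2) ^ (2 ^ d) := by omega
      _ ≤ (K * (N + 2) ^ B) ^ (2 ^ d) := Nat.pow_le_pow_left ht2 _
      _ = K ^ (2 ^ d) * (N + 2) ^ (B * 2 ^ d) := by rw [mul_pow, ← pow_mul]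
  have hclog : Nat.clog 2 (p.eval t) ≤ c₁ + D * (k + 2) := by
    calc Nat.clog 2 (p.eval t) ≤ Nat.clog 2 (K ^ (2 ^ d) * (N + 2) ^ (B * 2 ^ d)) :=
          Nat.clog_mono_right 2 hp
      _ ≤ Nat.clog 2 (K ^ (2 ^ d)) + Nat.clog 2 ((N + 2) ^ (B * 2 ^ d)) := clog_two_mul_le _ _
      _ ≤ c₁ + (B * 2 ^ d) * Nat.clog 2 (N + 2) := by
          rw [hc₁]; exact Nat.add_le_add_left (clog_two_pow_le _ _) _
      _ ≤ c₁ + D * (k + 2) := by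
          rw [hD]; exact Nat.add_le_add_left (Nat.mul_le_mul_left _ (clog_two_add_two_le N)) _
  have hw : (boolPair (encodeNat N) (encodeNat N)).length ≤ 3 * k + 5 := by
    rw [length_boolPair]; omega
  have hsum : (boolPair (encodeNat N) (encodeNat N)).length + (2 * e.length + 2) + Nat.clog 2 (p.eval t)
      ≤ (3 + D) * k + R := by
    have : (3 * k + 5) + (2 * e.length + 2) + (c₁ + D * (k + 2)) = (3 + D) * k + R := by
      rw [hR]; ring
    calc _ ≤ (3 * k + 5) + (2 * e.length + 2) + (c₁ + D * (k + 2)) :=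
          add_le_add (add_le_add hw le_rfl) hclog
      _ = (3 + D) * k + R := this
  have hfin : (3 + D) * k + R ≤ (3 + D + R) * k + (3 + D + R) := by
    have h1 : (3 + D) * k ≤ (3 + D + R) * k := Nat.mul_le_mul_right k (by omega)
    omega
  exact_mod_cast hsum.trans hfin

/-- `1^N ∈ MKtP[s]` as soon as `c·⌊log₂ N⌋ + c ≤ s(N)` for the constant of `levinKt_ones_le`.
[cite: OliveiraPichSanthanam2021, Def. 2.2] -/
theorem exists_forall_ones_mem_MKtP :
    ∃ c : ℕ, ∀ (s : ℕ → ℕ) (N : ℕ), c * Nat.log 2 N + c ≤ s N → ones N ∈ U.MKtP s := by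
  obtain ⟨c, hc⟩ := U.levinKt_ones_le
  refine ⟨c, fun s N hs => ?_⟩
  show U.levinKt (ones N) ≤ s (ones N).length
  have hlen : (ones N).length = N := by simp
  rw [hlen]
  exact (hc N).trans (by exact_mod_cast hs)

/-! ### Eventual comparisons of `c·log₂ N + c` with the census thresholds -/

/-- `⌊log₂ N⌋ ≤ log₂ N` (as reals). [folklore] -/
theorem natLog_two_le_logb (N : ℕ) : (Nat.log 2 N : ℝ) ≤ Real.logb 2 N := by
  rcases Nat.eq_zero_or_pos N with hN | hN
  · subst hN; simp
  · rw [← Real.natFloor_logb_natCast 2 N]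
    push_cast
    exact Nat.floor_le (Real.logb_nonneg (by norm_num) (by exact_mod_cast hN))

/-- For `β > 0` and any real `a`: `a·log₂ x + a ≤ x^β` for all large real `x` (`log x = o(x^β)`,
Mathlib's `isLittleO_log_rpow_atTop`). [folklore] -/
theorem eventually_mul_logb_add_le_rpow (a : ℝ) {β : ℝ} (hβ : 0 < β) :
    ∀ᶠ x : ℝ in atTop, a * Real.logb 2 x + a ≤ x ^ β := by
  rcases le_or_gt a 0 with ha | ha
  · filter_upwards [eventually_ge_atTop (1 : ℝ)] with x hx
    have hlog : 0 ≤ Real.logb 2 x := Real.logb_nonneg (by norm_num) hx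
    have hxβ : 0 ≤ x ^ β := Real.rpow_nonneg (by linarith) β
    nlinarith
  · have hlog2 : 0 < Real.log 2 := Real.log_pos (by norm_num)
    have hε : (0 : ℝ) < Real.log 2 / (2 * a + 1) := div_pos hlog2 (by linarith)
    have h1 := (isLittleO_log_rpow_atTop hβ).bound hε
    have h2 : ∀ᶠ x : ℝ in atTop, (1 : ℝ) ≤ Real.logb 2 x :=
      (Real.tendsto_logb_atTop (by norm_num : (1 : ℝ) < 2)).eventually_ge_atTop 1
    filter_upwards [h1, h2, eventually_ge_atTop (1 : ℝ)] with x hx h2x hx1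
    have hlogx : 0 ≤ Real.log x := Real.log_nonneg hx1
    have hxβ : 0 < x ^ β := Real.rpow_pos_of_pos (by linarith) β
    rw [Real.norm_of_nonneg hlogx, Real.norm_of_nonneg hxβ.le] at hx
    have hlb : Real.logb 2 x = Real.log x / Real.log 2 := rfl
    have h3 : a * Real.logb 2 x + a ≤ 2 * a * Real.logb 2 x := by nlinarith
    have h4 : 2 * a * Real.logb 2 x ≤ 2 * a / (2 * a + 1) * x ^ β := by
      have hmul := mul_le_mul_of_nonneg_left hx (by positivity : (0 : ℝ) ≤ 2 * a / Real.log 2)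
      calc 2 * a * Real.logb 2 x = 2 * a / Real.log 2 * Real.log x := by rw [hlb]; ring
        _ ≤ 2 * a / Real.log 2 * (Real.log 2 / (2 * a + 1) * x ^ β) := hmul
        _ = 2 * a / (2 * a + 1) * x ^ β := by field_simp
    have h5 : 2 * a / (2 * a + 1) * x ^ β ≤ x ^ β := by
      have : 2 * a / (2 * a + 1) ≤ 1 := by rw [div_le_one (by linarith)]; linarith
      exact mul_le_of_le_one_left hxβ.le this
    linarith

/-- For `β > 0`: `c·⌊log₂ N⌋ + c ≤ ⌊N^β⌋` for all large `N`. [folklore] -/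
theorem eventually_mul_log_add_le_powThreshold (c : ℕ) {β : ℝ} (hβ : 0 < β) :
    ∃ N₀ : ℕ, ∀ N : ℕ, N₀ ≤ N → c * Nat.log 2 N + c ≤ powThreshold β N := by
  obtain ⟨N₀, hN₀⟩ := eventually_atTop.1
    (tendsto_natCast_atTop_atTop.eventually (eventually_mul_logb_add_le_rpow (c : ℝ) hβ))
  refine ⟨N₀, fun N hN => ?_⟩
  have hA : (c : ℝ) * Real.logb 2 N + c ≤ (N : ℝ) ^ β := hN₀ N hN
  have hk : (Nat.log 2 N : ℝ) ≤ Real.logb 2 N := natLog_two_le_logb N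
  have hc0 : (0 : ℝ) ≤ c := Nat.cast_nonneg c
  unfold powThreshold
  apply Nat.le_floor
  push_cast
  nlinarith

/-- For `C ≥ 1` and `d ≥ 2`: `c·⌊log₂ N⌋ + c ≤ ⌊C (log₂ N)^d⌋` for all large `N`. [folklore] -/
theorem eventually_mul_log_add_le_logb_pow (c : ℕ) {C : ℝ} (hC : 1 ≤ C) {d : ℕ} (hd : 2 ≤ d) :
    ∃ N₀ : ℕ, ∀ N : ℕ, N₀ ≤ N → c * Nat.log 2 N + c ≤ ⌊C * Real.logb 2 N ^ d⌋₊ := by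
  have h2 : ∀ᶠ x : ℝ in atTop, (2 * c + 1 : ℝ) ≤ Real.logb 2 x :=
    (Real.tendsto_logb_atTop (by norm_num : (1 : ℝ) < 2)).eventually_ge_atTop _
  obtain ⟨N₀, hN₀⟩ := eventually_atTop.1 (tendsto_natCast_atTop_atTop.eventually h2)
  refine ⟨N₀, fun N hN => ?_⟩
  have hL : (2 * c + 1 : ℝ) ≤ Real.logb 2 N := hN₀ N hN
  have hk : (Nat.log 2 N : ℝ) ≤ Real.logb 2 N := natLog_two_le_logb N
  have hc0 : (0 : ℝ) ≤ c := Nat.cast_nonneg c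
  have hL1 : (1 : ℝ) ≤ Real.logb 2 N := by linarith
  apply Nat.le_floor
  push_cast
  calc (c : ℝ) * Nat.log 2 N + c ≤ c * Real.logb 2 N + c * Real.logb 2 N := by nlinarith
    _ ≤ Real.logb 2 N * Real.logb 2 N := by nlinarith
    _ = Real.logb 2 N ^ 2 := by ring
    _ ≤ Real.logb 2 N ^ d := pow_le_pow_right₀ hL1 hd
    _ ≤ C * Real.logb 2 N ^ d := le_mul_of_one_le_left (by positivity) hC

/-! ### YES-side inhabitedness -/

/-- **`1^N ∈ MKtP[N^β]` at every large length** (`β > 0`): the YES sides of OS18 Thm 3 /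
OPS21 Thms 1.1–1.2 / CJW `MKtP[n^α]` are inhabited. [cite: OliveiraPichSanthanam2021, Def. 2.2 (MKtP; inhabitedness folklore)] -/
theorem eventually_ones_mem_MKtP_powThreshold {β : ℝ} (hβ : 0 < β) :
    ∃ N₀ : ℕ, ∀ N : ℕ, N₀ ≤ N → ones N ∈ U.MKtP (powThreshold β) := by
  obtain ⟨c, hc⟩ := U.exists_forall_ones_mem_MKtP
  obtain ⟨N₀, hN₀⟩ := eventually_mul_log_add_le_powThreshold c hβ
  exact ⟨N₀, fun N hN => hc _ N (hN₀ N hN)⟩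

/-- **`1^N ∈ MKtP[C (log₂ N)^d]` at every large length** (`C ≥ 1`, `d ≥ 2`): the YES sides of
OPS21 Thm 1.3 (`Cn²`, `d = 2`) and of CJW20's `MKtP[(log n)^d]` (`C = 1`) are inhabited.
[cite: OliveiraPichSanthanam2021, Thm. 1.3 (YES threshold Cn²)] -/
theorem eventually_ones_mem_MKtP_logb_pow {C : ℝ} (hC : 1 ≤ C) {d : ℕ} (hd : 2 ≤ d) :
    ∃ N₀ : ℕ, ∀ N : ℕ, N₀ ≤ N → ones N ∈ U.MKtP (fun N => ⌊C * Real.logb 2 N ^ d⌋₊) := by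
  obtain ⟨c, hc⟩ := U.exists_forall_ones_mem_MKtP
  obtain ⟨N₀, hN₀⟩ := eventually_mul_log_add_le_logb_pow c hC hd
  exact ⟨N₀, fun N hN => hc _ N (hN₀ N hN)⟩

/-- The YES side of `Gap-MKtP[N^β, s₂]` (`β > 0`) contains `1^N` for every large `N` — with
`exists_mem_gapMKtP_no` both sides of the threshold problems of OS18 Thm 3 / OPS21 Thm 1.1 are
inhabited at every large length. [cite: OliveiraPichSanthanam2021, Def. 2.2] -/
theorem eventually_ones_mem_gapMKtP_yes_powThreshold {β : ℝ} (hβ : 0 < β) (s₂ : ℕ → ℕ) :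
    ∃ N₀ : ℕ, ∀ N : ℕ, N₀ ≤ N → ones N ∈ (U.gapMKtP (powThreshold β) s₂).yes := by
  simpa only [gapMKtP_yes] using U.eventually_ones_mem_MKtP_powThreshold hβ

/-- The YES side of `Gap-MKtP[C (log₂ N)^d, s₂]` (`C ≥ 1`, `d ≥ 2`) contains `1^N` for every large
`N`. [cite: OliveiraPichSanthanam2021, Thm. 1.3] -/
theorem eventually_ones_mem_gapMKtP_yes_logb_pow {C : ℝ} (hC : 1 ≤ C) {d : ℕ} (hd : 2 ≤ d)
    (s₂ : ℕ → ℕ) :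
    ∃ N₀ : ℕ, ∀ N : ℕ, N₀ ≤ N → ones N ∈ (U.gapMKtP (fun N => ⌊C * Real.logb 2 N ^ d⌋₊) s₂).yes := by
  simpa only [gapMKtP_yes] using U.eventually_ones_mem_MKtP_logb_pow hC hd

end UniversalMachine

end Literature.Computability.MetaComplexity
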